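import Mathlib
import HarnessLib
import Summits.Ventures.LatticeQCDFlow.Scoring.AllPairsAcceptanceRatioCeilingFree
import Summits.Ventures.LatticeQCDFlow.Scoring.SelfNormalisedReweightingCeilingFree
import Summits.Ventures.LatticeQCDFlow.Scoring.KishESSCeilingFree

/-!
# The flow card from ONE proposal stream, ceiling-free: the three printed columns — acceptance,
# ESS, reweighted observable — read as medians over `R` blocks are SIMULTANEOUSLY within their
# radii of `acc(p, q)`, `ESS = 1/M₂`, `E_p O` with probability `≥ 1 − 3e^{−R/8}`

HONEST FRAMING: exact (Metropolis-corrected) sampling algorithms for lattice gauge theory;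
figures of merit are autocorrelation/cost numbers at stated couplings and volumes; no
continuum-physics claim.

Venture `LatticeQCDFlow` (cell pub-lqcd), topic `Scoring`; FANOUT row 4 (`s0-u1-b`, rung S0-B:
two independent codes compared column by column — the 'A-vs-B agreement table').  Row 4's
ceiling-free files certify each printed column of a flow code separately from ONE stream of `n`
i.i.d. proposals cut into `R` blocks of `m`, for weights printed with ANY normalisation
`w̃ = c·p/q` (`c = Z` unknown):
* acceptance — `Scoring/AllPairsAcceptanceRatioCeilingFree`
  (`printedAcceptance_sampleMedian_confidence`: block all-pairs ratio `Û_r/W̄_r`, radius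
  `(t_a + u)/(1 − u)`, inputs `8/(m − 1) ≤ t_a²`, `8(M₂ − 1) ≤ m u²`);
* ESS — `Scoring/KishESSCeilingFree` (`kishESS_sampleMedian_confidence_abs`: block Kish fraction,
  radius `(u(2 + u) + s)/(1 − s)`, extra input `8(M₄ − M₂²) ≤ m s² M₂²`);
* observable — `Scoring/SelfNormalisedReweightingCeilingFree`
  (`selfNormReweighting_sampleMedian_confidence`: block self-normalised estimate, radius
  `(t_o + Bu)/(1 − u)`, input `8B²M₂ ≤ m t_o²` for `|O| ≤ B`).
This file only assembles them: the three bad events live on the SAME probability space (one run,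
one stream), so a union bound gives the whole card at confidence `1 − 3e^{−R/8}`, i.e. `1 − η` with
`R ≥ 8 log(3/η)` blocks; two codes' cards compare column by column by adding radii (A versus B is
`add_le_add` of two cards, each on its own probability space, nothing assumed between the codes).
NEW WORK of the cell (bookkeeping); no definition; nothing cited as a fact.

## Content (`M₂ = ∫ p²/q dμ = 1/ESS`, `M₄ = ∫ p⁴/q³ dμ`, `acc = ∫∫ min(p(a)q(b), p(b)q(a)) dμ dμ`)

* `three_mul_exp_neg_blocks_le` — `0 < η`, `8 log(3/η) ≤ R` ⇒ `3e^{−R/8} ≤ η`.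
* **`flowCard_sampleMedians_confidence`** — for ANY sample-median selections `medA`, `medK`,
  `medO` of the three printed block columns:
  `P( ρ_a ≤ |medA − acc| ∨ ρ_k ≤ |medK − ESS| ∨ ρ_o ≤ |medO − E_p O| ) ≤ 3 exp(−R/8)`.
* `flowCard_sampleMedians_confidence_eta` — the same at level `η` for `8 log(3/η) ≤ R`.

NOT CLAIMED: the `τ_int` column (chain-side; see the `Scoring/FlowSampler*` and `Scoring/IMH*`
files); data-driven radii; estimating `M₂`, `M₄` (inputs); any number of ours re-scored; nothing
boarded.
-/

noncomputable section

namespace Summit.Ventures.LatticeQCDFlow.Scoring.FlowCard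

open MeasureTheory ProbabilityTheory Finset Real Set
open Summit.Ventures.LatticeQCDFlow.Scoring.BlockMedian
open Summit.Ventures.LatticeQCDFlow.Scoring.AllPairsMedian
open Summit.Ventures.LatticeQCDFlow.Scoring.ReweightingMedian
open Summit.Ventures.LatticeQCDFlow.Scoring.KishESSMedian

/-- **Block count for a card at confidence `1 − η`**: `0 < η`, `8 log(3/η) ≤ R` ⇒ `3e^{−R/8} ≤ η`.
[ours] -/
theorem three_mul_exp_neg_blocks_le {R : ℕ} {η : ℝ} (hη : 0 < η)
    (hR : 8 * Real.log (3 / η) ≤ R) : 3 * exp (-((R : ℝ) / 8)) ≤ η := by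
  have hη3 : 0 < η / 3 := by positivity
  have h := exp_neg_blocks_le (R := R) hη3 (by rwa [one_div, inv_div])
  linarith

variable {Ω : Type*} [MeasurableSpace Ω] {P : Measure Ω} [IsProbabilityMeasure P]
variable {X : Type*} [MeasurableSpace X] {μ : Measure X} [SFinite μ] {p q O : X → ℝ} {n m R : ℕ}

/-- **THE CEILING-FREE FLOW CARD FROM ONE STREAM.**  `n` independent model draws `y_j` (laws
`μ.withDensity q`); `p ≥ 0` measurable, integrable, `∫ p = 1`, `p²/q, p⁴/q³ ∈ L¹(μ)`; `q > 0`
measurable, integrable; `O` measurable with `|O| ≤ B`; weights printed with ANY normalisation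
`w̃ = c·p/q`, `c > 0`; blocks of `m ≥ 2` draws, `R·m ≤ n`; radii parameters `t_a, t_o > 0`,
`0 < u < 1`, `0 < s < 1` with `8/(m − 1) ≤ t_a²`, `8(M₂ − 1) ≤ m u²`, `8(M₄ − M₂²) ≤ m s² M₂²`,
`8B²M₂ ≤ m t_o²`; `medA`, `medK`, `medO` ANY sample-median selections of the printed block
acceptance ratios, Kish fractions and self-normalised estimates.  Then the event 'some column of
the card is off by its radius' — `(t_a + u)/(1 − u) ≤ |medA − acc(p,q)|` or
`(u(2 + u) + s)/(1 − s) ≤ |medK − 1/M₂|` or `(t_o + Bu)/(1 − u) ≤ |medO − ∫ p·O dμ|` — has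
probability `≤ 3 exp(−R/8)`. [ours] -/
theorem flowCard_sampleMedians_confidence {y : Fin n → Ω → X} (hym : ∀ j, Measurable (y j))
    (hind : iIndepFun y P) (hp0 : ∀ z, 0 ≤ p z) (hpm : Measurable p) (hpi : Integrable p μ)
    (hp1 : ∫ z, p z ∂μ = 1) (hq0 : ∀ z, 0 < q z) (hqm : Measurable q) (hqi : Integrable q μ)
    (hM2i : Integrable (fun z => p z ^ 2 / q z) μ)
    (hM4i : Integrable (fun z => p z ^ 4 / q z ^ 3) μ) (hOm : Measurable O) {B : ℝ}
    (hOB : ∀ z, |O z| ≤ B)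
    (hlaw : ∀ j, Measure.map (y j) P = μ.withDensity fun z => ENNReal.ofReal (q z))
    {wt : X → ℝ} {c : ℝ} (hc : 0 < c) (hwt : ∀ z, wt z = c * (p z / q z))
    (hm : 2 ≤ m) (hRm : R * m ≤ n) {ta tb u s : ℝ} (hta : 0 < ta) (htb : 0 < tb) (hu : 0 < u)
    (hu1 : u < 1) (hs : 0 < s) (hs1 : s < 1) (hmt : 8 / (m - 1 : ℝ) ≤ ta ^ 2)
    (hvu : 8 * ((∫ z, p z ^ 2 / q z ∂μ) - 1) ≤ m * u ^ 2)
    (hvs : 8 * ((∫ z, p z ^ 4 / q z ^ 3 ∂μ) - (∫ z, p z ^ 2 / q z ∂μ) ^ 2)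
      ≤ m * s ^ 2 * (∫ z, p z ^ 2 / q z ∂μ) ^ 2)
    (hvt : 8 * (B ^ 2 * ∫ z, p z ^ 2 / q z ∂μ) ≤ m * tb ^ 2)
    {medA medK medO : Ω → ℝ}
    (hloA : ∀ ω, (R : ℝ) / 2 ≤ #{r ∈ (univ : Finset (Fin R)) | medA ω ≤
        ((∑ z ∈ (univ : Finset (Fin m)).offDiag,
              min (wt (y ⟨((r : Fin R) : ℕ) * m + z.1, mul_add_lt hRm r z.1⟩ ω))
                (wt (y ⟨((r : Fin R) : ℕ) * m + z.2, mul_add_lt hRm r z.2⟩ ω)))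
              / (m * (m - 1) : ℝ))
            / ((∑ j : Fin m, wt (y ⟨((r : Fin R) : ℕ) * m + j, mul_add_lt hRm r j⟩ ω)) / m)})
    (hhiA : ∀ ω, (R : ℝ) / 2 ≤ #{r ∈ (univ : Finset (Fin R)) |
        ((∑ z ∈ (univ : Finset (Fin m)).offDiag,
              min (wt (y ⟨((r : Fin R) : ℕ) * m + z.1, mul_add_lt hRm r z.1⟩ ω))
                (wt (y ⟨((r : Fin R) : ℕ) * m + z.2, mul_add_lt hRm r z.2⟩ ω)))
              / (m * (m - 1) : ℝ))
            / ((∑ j : Fin m, wt (y ⟨((r : Fin R) : ℕ) * m + j, mul_add_lt hRm r j⟩ ω)) / m)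
          ≤ medA ω})
    (hloK : ∀ ω, (R : ℝ) / 2 ≤ #{r ∈ (univ : Finset (Fin R)) | medK ω ≤
        kishESS (univ : Finset (Fin m))
          (fun j => wt (y ⟨((r : Fin R) : ℕ) * m + j, mul_add_lt hRm r j⟩ ω)) / m})
    (hhiK : ∀ ω, (R : ℝ) / 2 ≤ #{r ∈ (univ : Finset (Fin R)) |
        kishESS (univ : Finset (Fin m))
          (fun j => wt (y ⟨((r : Fin R) : ℕ) * m + j, mul_add_lt hRm r j⟩ ω)) / m ≤ medK ω})
    (hloO : ∀ ω, (R : ℝ) / 2 ≤ #{r ∈ (univ : Finset (Fin R)) | medO ω ≤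
        (∑ j : Fin m, wt (y ⟨((r : Fin R) : ℕ) * m + j, mul_add_lt hRm r j⟩ ω)
              * O (y ⟨((r : Fin R) : ℕ) * m + j, mul_add_lt hRm r j⟩ ω))
            / (∑ j : Fin m, wt (y ⟨((r : Fin R) : ℕ) * m + j, mul_add_lt hRm r j⟩ ω))})
    (hhiO : ∀ ω, (R : ℝ) / 2 ≤ #{r ∈ (univ : Finset (Fin R)) |
        (∑ j : Fin m, wt (y ⟨((r : Fin R) : ℕ) * m + j, mul_add_lt hRm r j⟩ ω)
              * O (y ⟨((r : Fin R) : ℕ) * m + j, mul_add_lt hRm r j⟩ ω))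
            / (∑ j : Fin m, wt (y ⟨((r : Fin R) : ℕ) * m + j, mul_add_lt hRm r j⟩ ω))
          ≤ medO ω}) :
    P.real ({ω | (ta + u) / (1 - u) ≤ |medA ω - ∫ a, ∫ b, min (p a * q b) (p b * q a) ∂μ ∂μ|}
        ∪ {ω | (u * (2 + u) + s) / (1 - s) ≤ |medK ω - (∫ z, p z ^ 2 / q z ∂μ)⁻¹|}
        ∪ {ω | (tb + B * u) / (1 - u) ≤ |medO ω - ∫ z, p z * O z ∂μ|})
      ≤ 3 * exp (-(R / 8)) := by
  have hm1 : 1 ≤ m := le_trans (by norm_num) hm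
  have hA := printedAcceptance_sampleMedian_confidence hym hind hp0 hpm hpi hp1 hq0 hqm hqi hM2i
    hlaw hc hwt hm hRm hta hu hu1 hmt hvu hloA hhiA
  have hK := kishESS_sampleMedian_confidence_abs hym hind hpm hpi hp1 hq0 hqm hM2i hM4i hlaw hc
    hwt hm1 hRm hu hs hs1 hvu hvs hloK hhiK
  have hO := selfNormReweighting_sampleMedian_confidence hym hind hp0 hpm hpi hp1 hq0 hqm hM2i hOm
    hOB hlaw hc hwt hm1 hRm htb hu hu1 hvt hvu hloO hhiO
  calc P.real _ ≤ P.real _ + P.real _ := measureReal_union_le _ _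
    _ ≤ (P.real _ + P.real _) + P.real _ := by
        gcongr
        exact measureReal_union_le _ _
    _ ≤ (exp (-(R / 8)) + exp (-(R / 8))) + exp (-(R / 8)) :=
        add_le_add (add_le_add hA hK) hO
    _ = 3 * exp (-(R / 8)) := by ring

/-- **THE CEILING-FREE FLOW CARD AT LEVEL `η`**: under the hypotheses of
`flowCard_sampleMedians_confidence` and `8 log(3/η) ≤ R` (`η > 0`), the probability that some
column of the card is off by its radius is `≤ η`. [ours] -/
theorem flowCard_sampleMedians_confidence_eta {y : Fin n → Ω → X} (hym : ∀ j, Measurable (y j))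
    (hind : iIndepFun y P) (hp0 : ∀ z, 0 ≤ p z) (hpm : Measurable p) (hpi : Integrable p μ)
    (hp1 : ∫ z, p z ∂μ = 1) (hq0 : ∀ z, 0 < q z) (hqm : Measurable q) (hqi : Integrable q μ)
    (hM2i : Integrable (fun z => p z ^ 2 / q z) μ)
    (hM4i : Integrable (fun z => p z ^ 4 / q z ^ 3) μ) (hOm : Measurable O) {B : ℝ}
    (hOB : ∀ z, |O z| ≤ B)
    (hlaw : ∀ j, Measure.map (y j) P = μ.withDensity fun z => ENNReal.ofReal (q z))
    {wt : X → ℝ} {c : ℝ} (hc : 0 < c) (hwt : ∀ z, wt z = c * (p z / q z))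
    (hm : 2 ≤ m) (hRm : R * m ≤ n) {ta tb u s η : ℝ} (hta : 0 < ta) (htb : 0 < tb)
    (hu : 0 < u) (hu1 : u < 1) (hs : 0 < s) (hs1 : s < 1) (hmt : 8 / (m - 1 : ℝ) ≤ ta ^ 2)
    (hvu : 8 * ((∫ z, p z ^ 2 / q z ∂μ) - 1) ≤ m * u ^ 2)
    (hvs : 8 * ((∫ z, p z ^ 4 / q z ^ 3 ∂μ) - (∫ z, p z ^ 2 / q z ∂μ) ^ 2)
      ≤ m * s ^ 2 * (∫ z, p z ^ 2 / q z ∂μ) ^ 2)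
    (hvt : 8 * (B ^ 2 * ∫ z, p z ^ 2 / q z ∂μ) ≤ m * tb ^ 2) (hη : 0 < η)
    (hR : 8 * Real.log (3 / η) ≤ R) {medA medK medO : Ω → ℝ}
    (hloA : ∀ ω, (R : ℝ) / 2 ≤ #{r ∈ (univ : Finset (Fin R)) | medA ω ≤
        ((∑ z ∈ (univ : Finset (Fin m)).offDiag,
              min (wt (y ⟨((r : Fin R) : ℕ) * m + z.1, mul_add_lt hRm r z.1⟩ ω))
                (wt (y ⟨((r : Fin R) : ℕ) * m + z.2, mul_add_lt hRm r z.2⟩ ω)))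
              / (m * (m - 1) : ℝ))
            / ((∑ j : Fin m, wt (y ⟨((r : Fin R) : ℕ) * m + j, mul_add_lt hRm r j⟩ ω)) / m)})
    (hhiA : ∀ ω, (R : ℝ) / 2 ≤ #{r ∈ (univ : Finset (Fin R)) |
        ((∑ z ∈ (univ : Finset (Fin m)).offDiag,
              min (wt (y ⟨((r : Fin R) : ℕ) * m + z.1, mul_add_lt hRm r z.1⟩ ω))
                (wt (y ⟨((r : Fin R) : ℕ) * m + z.2, mul_add_lt hRm r z.2⟩ ω)))
              / (m * (m - 1) : ℝ))
            / ((∑ j : Fin m, wt (y ⟨((r : Fin R) : ℕ) * m + j, mul_add_lt hRm r j⟩ ω)) / m)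
          ≤ medA ω})
    (hloK : ∀ ω, (R : ℝ) / 2 ≤ #{r ∈ (univ : Finset (Fin R)) | medK ω ≤
        kishESS (univ : Finset (Fin m))
          (fun j => wt (y ⟨((r : Fin R) : ℕ) * m + j, mul_add_lt hRm r j⟩ ω)) / m})
    (hhiK : ∀ ω, (R : ℝ) / 2 ≤ #{r ∈ (univ : Finset (Fin R)) |
        kishESS (univ : Finset (Fin m))
          (fun j => wt (y ⟨((r : Fin R) : ℕ) * m + j, mul_add_lt hRm r j⟩ ω)) / m ≤ medK ω})
    (hloO : ∀ ω, (R : ℝ) / 2 ≤ #{r ∈ (univ : Finset (Fin R)) | medO ω ≤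
        (∑ j : Fin m, wt (y ⟨((r : Fin R) : ℕ) * m + j, mul_add_lt hRm r j⟩ ω)
              * O (y ⟨((r : Fin R) : ℕ) * m + j, mul_add_lt hRm r j⟩ ω))
            / (∑ j : Fin m, wt (y ⟨((r : Fin R) : ℕ) * m + j, mul_add_lt hRm r j⟩ ω))})
    (hhiO : ∀ ω, (R : ℝ) / 2 ≤ #{r ∈ (univ : Finset (Fin R)) |
        (∑ j : Fin m, wt (y ⟨((r : Fin R) : ℕ) * m + j, mul_add_lt hRm r j⟩ ω)
              * O (y ⟨((r : Fin R) : ℕ) * m + j, mul_add_lt hRm r j⟩ ω))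
            / (∑ j : Fin m, wt (y ⟨((r : Fin R) : ℕ) * m + j, mul_add_lt hRm r j⟩ ω))
          ≤ medO ω}) :
    P.real ({ω | (ta + u) / (1 - u) ≤ |medA ω - ∫ a, ∫ b, min (p a * q b) (p b * q a) ∂μ ∂μ|}
        ∪ {ω | (u * (2 + u) + s) / (1 - s) ≤ |medK ω - (∫ z, p z ^ 2 / q z ∂μ)⁻¹|}
        ∪ {ω | (tb + B * u) / (1 - u) ≤ |medO ω - ∫ z, p z * O z ∂μ|}) ≤ η :=
  (flowCard_sampleMedians_confidence hym hind hp0 hpm hpi hp1 hq0 hqm hqi hM2i hM4i hOm hOB hlaw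
    hc hwt hm hRm hta htb hu hu1 hs hs1 hmt hvu hvs hvt hloA hhiA hloK hhiK hloO hhiO).trans
    (three_mul_exp_neg_blocks_le hη hR)

end Summit.Ventures.LatticeQCDFlow.Scoring.FlowCard

end
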